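import Summits.QuantumFields.BalabanUV.Beta.GAN24.CombQuarticTableLawTwinsD
import Summits.QuantumFields.BalabanUV.Beta.GAN24.CombChargeParityOddOfQuarticLaw
import Summits.QuantumFields.BalabanUV.Beta.GAN24.CombesThomas

/-!
# `BalabanUV.Beta.GAN24.CombChargeParityOddLiteral` — binder row G-an2-4 ∕ (CONV-C), W-slot, row (C) at levels ≥ 1: **THE ODD-PATTERN HALF OF (C)_{≥1} AT THE LITERAL OF RECORD,
# UNCONDITIONALLY** — the comb tower's member charges are LEG-ANTISYMMETRIC on every pattern with an axis of odd multiplicity (216 of the 256 patterns at `d + 1 = 4`), at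
# EVERY level, for the literal `JsRowD1Pin hLc N`'s quartic table — hypotheses `Odd Lc`, `2 ≤ N` ONLY; hence MY (D) `WrecAtEvenHalfRowsOfQLCSymLeg` §3's display `hZ₂`
# (leg-summed bond-symmetrised charge conservation at levels ≥ 1) HOLDS ON THOSE PATTERNS WITH BOTH SIDES ZERO (road-P2 chair of row G-an2-4, unit `b2b-balaban-gan24-p2` gen 48)

NOT IN PRINT; OUR BOOKKEEPING ([folklore] wiring BY NAME; twin of an2's END with the root call swapped and the kernel-only binders dropped; 0 `def`, 0 cited facts, 0 `def … : Prop`,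
0 sorry).  HONEST FRAMING (cell contract, verbatim): «discharging `BetaPertH` makes Bałaban's UV stability UNCONDITIONAL — a real constructive-QFT result; it is NOT the continuum
limit and NOT the Clay problem.»  HONEST DEPENDENCY (verbatim): «continuum YM on T⁴ ⇐ BetaPertH ∧ nine spine estimates (0/9 proved); BetaPertH ⇐ (D1) ∧ (D4) ∧ CAP+tail; G-an2-4
gates asym, D1 and NE2/3/4.»

WHAT (`ρ_c = toSite (ctrOff 4 Lc)`, `T̂_j := T2RecAt 3 Lc ρ_c Lc⁴ (−Lc⁸∕2) (2∕Lc⁴) Lc⁸ (−Lc¹²∕4) ((8N²)⁻¹•wsym22 N) (vh₂SAn1 Lc) (mixFFAt ρ_c Lc) j` — THE quartic table of the literal):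
* §1 **`zmode_T2RecAt_JsRowD1Pin_add_legSwap_eq_zero (hLc : Odd Lc) (hN : 2 ≤ N) (j) (hodd : ∃ α, ε_κ ε_κ′ ε_κ₁ ε_κ₂ = −1) :
  zmode Lc T̂_j κ κ′ (inl κ₁) (inl κ₂) + zmode Lc T̂_j κ κ′ (inl κ₂) (inl κ₁) = 0`** — MY `CombQuarticTableLawLiteral.T2RecAt_bref_all_JsRowD1Pin` (W-an2-1: an2's chain twinned to
  the table level) ⨾ MY `CombChargeParityOddOfQuarticLaw.zmode_T2RecAt_add_legSwap_eq_zero_of_law` (parity with defect: the contact carries no charge —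
  `CombQuarticContactChargeZero` over `CombCubicCellChargeZero` —, the remainder is row-parity-odd).
* §2 `zmode_unitS₂_T2RecAt_JsRowD1Pin_add_legSwap_eq_zero`: the same for the member in ANY step units `unitS₂ sf sm T̂_j`.
* §3 **`zsymLegSym_conserved_succ_of_oddAxis`**: in the (D)-capstones' spelling (pins as equations `hcE … hvh`, root `r = ctrOff 4 Lc`), for every `l` and every odd-axis pattern the
  `hZ₂` equation of `WrecAtEvenHalfRowsOfQLCSymLeg.exists_allScalesSeq_JsRowD1Pin_of_QL_zsymLegSymConservedSucc` holds — both leg-summed bond-symmetrised charges VANISH.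
SO (located, zero weight): after this file the literal's (C) display at levels ≥ 1 is OWED on the two-pair class `{a,a,b,b}` (36 patterns) and the all-equal class (4) ONLY — the
(TL) programme's targets (leaf-06 EX side ∕ leaf-02 CT sectors ∕ leaf-04 dead words ∕ an2 site law); every odd-multiplicity pattern needs NO valuation.  HONEST: the mathematics is an2's
reflection chain (gens 16–21) + an3's∕an1's table laws + the D1 swarm's classes, re-plumbed one step short of the kernel, + g47∕g48's parity files; asserts NOTHING about Bałaban's
tables beyond the tree's DEFINED ones; discharges NOTHING of (Q-L) ∕ (H1♮) ∕ the two-pair∕all-equal rows of (C)_{≥1} ∕ (hW, hWall); (β) of record untouched; NEVER «G-an2-4 closed» as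
(CONV-C); NOT D1, NOT `BetaPertH`, NOT continuum, NOT Clay.  2026-08-23; no existing file touched.
-/

noncomputable section

open Finset
open scoped BigOperators
open Literature.MathematicalPhysics.QuantumFieldTheory
open Literature.MathematicalPhysics.QuantumFieldTheory.Balaban1983to89
open Literature.MathematicalPhysics.QuantumFieldTheory.Balaban1983to89.Beta
open ExpKernelCalculus (MKer shiftK)
open OneStepResolventKernel (Fib)
open AffineAveraging (box toSite)
open AveragingContoursRooted (ctrOff ctrOff_mem_box)
open PolarizationSign (reflSign)
open BalabanStepJetsSucc (wVH)
open Summit.QuantumFields.BalabanUV.Beta.BorderedHessian (stepScale)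
open Summit.QuantumFields.BalabanUV.Beta.SecondOrderUnits (unitS₂)
open Summit.QuantumFields.BalabanUV.Beta.SecondOrderTableLawEnd (locStencil₂_vh₂SAn1 vh₂SAn1_translate)
open Summit.QuantumFields.BalabanUV.Beta.MixedJetTablesPlug (hmix_an1 hmixt_an1)
open Summit.QuantumFields.BalabanUV.Beta.GAN24.BiStencilZeroMode (zmode)
open Summit.QuantumFields.BalabanUV.Beta.GAN24.CombesThomas (sfStep smStep)
open Summit.QuantumFields.BalabanUV.Beta.GAN24.CombQuarticTableLawLiteral (T2RecAt_bref_all_JsRowD1Pin)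
open Summit.QuantumFields.BalabanUV.Beta.GAN24.CombChargeParityOddOfQuarticLaw (zmode_T2RecAt_add_legSwap_eq_zero_of_law zmode_unitS₂_T2RecAt_add_legSwap_eq_zero_of_law)

namespace Summit.QuantumFields.BalabanUV.Beta.GAN24.CombChargeParityOddLiteral

variable {Lc : ℕ} [NeZero Lc]

/-- NOT IN PRINT; OUR BOOKKEEPING.  §1 **LEG-ANTISYMMETRIC CHARGE OF THE LITERAL's QUARTIC TABLE ON EVERY ODD-AXIS PATTERN, EVERY LEVEL — `Odd Lc`, `2 ≤ N` ONLY.** -/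
theorem zmode_T2RecAt_JsRowD1Pin_add_legSwap_eq_zero (hLc : Odd Lc) {N : ℕ} (hN : 2 ≤ N) (j : ℕ) {κ κ' κ₁ κ₂ : Fin 4}
    (hodd : ∃ α : Fin 4, reflSign α κ * reflSign α κ' * reflSign α κ₁ * reflSign α κ₂ = -1) :
    zmode Lc (SpineRooted.T2RecAt 3 Lc (AffineAveraging.toSite (AveragingContoursRooted.ctrOff 4 Lc)) ((Lc : ℝ) ^ 4) (-((Lc : ℝ) ^ 8 / 2)) (2 / (Lc : ℝ) ^ 4) ((Lc : ℝ) ^ 8) (-((Lc : ℝ) ^ 12 / 4)) ((8 * (N : ℝ) ^ 2)⁻¹ • WilsonVertex2Sym.wsym22 N) (SecondOrderSocketIdentification.vh₂SAn1 Lc) (AveragingMixedJetTables.mixFFAt (AffineAveraging.toSite (AveragingContoursRooted.ctrOff 4 Lc)) Lc) j) κ κ' (Sum.inl κ₁) (Sum.inl κ₂)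
      + zmode Lc (SpineRooted.T2RecAt 3 Lc (AffineAveraging.toSite (AveragingContoursRooted.ctrOff 4 Lc)) ((Lc : ℝ) ^ 4) (-((Lc : ℝ) ^ 8 / 2)) (2 / (Lc : ℝ) ^ 4) ((Lc : ℝ) ^ 8) (-((Lc : ℝ) ^ 12 / 4)) ((8 * (N : ℝ) ^ 2)⁻¹ • WilsonVertex2Sym.wsym22 N) (SecondOrderSocketIdentification.vh₂SAn1 Lc) (AveragingMixedJetTables.mixFFAt (AffineAveraging.toSite (AveragingContoursRooted.ctrOff 4 Lc)) Lc) j) κ κ' (Sum.inl κ₂) (Sum.inl κ₁) = 0 := by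
  obtain ⟨R2, hR2c, hR2p, hlaw⟩ := T2RecAt_bref_all_JsRowD1Pin hLc hN
  exact zmode_T2RecAt_add_legSwap_eq_zero_of_law hLc (2 / (Lc : ℝ) ^ 4) ((Lc : ℝ) ^ 8) (-((Lc : ℝ) ^ 12 / 4)) ((8 * (N : ℝ) ^ 2)⁻¹ • WilsonVertex2Sym.wsym22 N)
    (locStencil₂_vh₂SAn1 hLc) (vh₂SAn1_translate hLc.pos) (hmix_an1 (d := 3) hLc.pos (ctrOff_mem_box hLc.pos)) (hmixt_an1 (toSite (ctrOff 4 Lc))) j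
    (-((Lc : ℝ) ^ 8 / 2) * wVH 3 Lc j / (stepScale 3 Lc j * (Lc : ℝ) ^ 4)) ((-((Lc : ℝ) ^ 8 / 2) * wVH 3 Lc j / (stepScale 3 Lc j * (Lc : ℝ) ^ 4)) ^ 2)
    (fun α => R2 j α) (fun α => hR2c j α) (fun α => hR2p j α) (fun α κ u κ' u' => hlaw j α κ u κ' u') hodd

/-- NOT IN PRINT; OUR BOOKKEEPING.  §2 **THE SAME FOR THE MEMBER IN ANY STEP UNITS** `unitS₂ sf sm T̂_j`. -/
theorem zmode_unitS₂_T2RecAt_JsRowD1Pin_add_legSwap_eq_zero (hLc : Odd Lc) {N : ℕ} (hN : 2 ≤ N) (j : ℕ) (sf sm : ℝ) {κ κ' κ₁ κ₂ : Fin 4}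
    (hodd : ∃ α : Fin 4, reflSign α κ * reflSign α κ' * reflSign α κ₁ * reflSign α κ₂ = -1) :
    zmode Lc (unitS₂ sf sm (SpineRooted.T2RecAt 3 Lc (AffineAveraging.toSite (AveragingContoursRooted.ctrOff 4 Lc)) ((Lc : ℝ) ^ 4) (-((Lc : ℝ) ^ 8 / 2)) (2 / (Lc : ℝ) ^ 4) ((Lc : ℝ) ^ 8) (-((Lc : ℝ) ^ 12 / 4)) ((8 * (N : ℝ) ^ 2)⁻¹ • WilsonVertex2Sym.wsym22 N) (SecondOrderSocketIdentification.vh₂SAn1 Lc) (AveragingMixedJetTables.mixFFAt (AffineAveraging.toSite (AveragingContoursRooted.ctrOff 4 Lc)) Lc) j)) κ κ' (Sum.inl κ₁) (Sum.inl κ₂)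
      + zmode Lc (unitS₂ sf sm (SpineRooted.T2RecAt 3 Lc (AffineAveraging.toSite (AveragingContoursRooted.ctrOff 4 Lc)) ((Lc : ℝ) ^ 4) (-((Lc : ℝ) ^ 8 / 2)) (2 / (Lc : ℝ) ^ 4) ((Lc : ℝ) ^ 8) (-((Lc : ℝ) ^ 12 / 4)) ((8 * (N : ℝ) ^ 2)⁻¹ • WilsonVertex2Sym.wsym22 N) (SecondOrderSocketIdentification.vh₂SAn1 Lc) (AveragingMixedJetTables.mixFFAt (AffineAveraging.toSite (AveragingContoursRooted.ctrOff 4 Lc)) Lc) j)) κ κ' (Sum.inl κ₂) (Sum.inl κ₁) = 0 := by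
  obtain ⟨R2, hR2c, hR2p, hlaw⟩ := T2RecAt_bref_all_JsRowD1Pin hLc hN
  exact zmode_unitS₂_T2RecAt_add_legSwap_eq_zero_of_law hLc (2 / (Lc : ℝ) ^ 4) ((Lc : ℝ) ^ 8) (-((Lc : ℝ) ^ 12 / 4)) ((8 * (N : ℝ) ^ 2)⁻¹ • WilsonVertex2Sym.wsym22 N)
    (locStencil₂_vh₂SAn1 hLc) (vh₂SAn1_translate hLc.pos) (hmix_an1 (d := 3) hLc.pos (ctrOff_mem_box hLc.pos)) (hmixt_an1 (toSite (ctrOff 4 Lc))) j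
    (-((Lc : ℝ) ^ 8 / 2) * wVH 3 Lc j / (stepScale 3 Lc j * (Lc : ℝ) ^ 4)) ((-((Lc : ℝ) ^ 8 / 2) * wVH 3 Lc j / (stepScale 3 Lc j * (Lc : ℝ) ^ 4)) ^ 2)
    (fun α => R2 j α) (fun α => hR2c j α) (fun α => hR2p j α) (fun α κ u κ' u' => hlaw j α κ u κ' u') sf sm hodd

/-- NOT IN PRINT; OUR BOOKKEEPING.  §3 **THE (D) §3 DISPLAY `hZ₂` ON THE ODD-AXIS PATTERNS — BOTH SIDES VANISH** (the capstones' spelling: pins as equations, root `r = ctrOff 4 Lc`, border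
table `vh₂S = vh₂SAn1 Lc`): for every `l`, the leg-summed bond-symmetrised charges of `T̃_{l+2}` and `T̃_{l+1}` are equal (indeed both `0`) on every pattern with an axis of odd
multiplicity (the multiset `{κ, κ′, κ₁, κ₂}` is invariant under the bond swap and the leg swap, so all four summands pair off by §2). -/
theorem zsymLegSym_conserved_succ_of_oddAxis (hLc : Odd Lc) {N : ℕ} (hN : 2 ≤ N) {r : Fin (3 + 1) → ℕ} (hr : r = ctrOff (3 + 1) Lc)
    {cE cVH cΛ cE₂ cB : ℝ} (hcE : cE = (Lc : ℝ) ^ (3 + 1)) (hcVH : cVH = -((Lc : ℝ) ^ (3 + 1) * (1 / 2) * (Lc : ℝ) ^ (3 + 1))) (hcΛ : cΛ = 2 / (Lc : ℝ) ^ 4) (hcE₂ : cE₂ = (Lc : ℝ) ^ (2 * (3 + 1)))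
    (hcB : cB = -((Lc : ℝ) ^ 12 / 4)) {Tc : Fin 4 → Fin 4 → Fin 4 → Fin 4 → ℝ} (hTc : Tc = (8 * (N : ℝ) ^ 2)⁻¹ • WilsonVertex2Sym.wsym22 N)
    {vh₂S : Fin (3 + 1) → (Fin (3 + 1) → ℤ) → Fin (3 + 1) → (Fin (3 + 1) → ℤ) → MKer (3 + 1) (Fib 3)} (hvh : vh₂S = SecondOrderSocketIdentification.vh₂SAn1 Lc)
    (l : ℕ) {κ κ' κ₁ κ₂ : Fin (3 + 1)} (hodd : ∃ α : Fin 4, reflSign α κ * reflSign α κ' * reflSign α κ₁ * reflSign α κ₂ = -1) :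
    zmode Lc (unitS₂ (sfStep Lc (l + 1 + 1)) (smStep 3 Lc (l + 1 + 1)) (SpineRooted.T2RecAt 3 Lc (AffineAveraging.toSite r) cE cVH cΛ cE₂ cB Tc vh₂S (AveragingMixedJetTables.mixFFAt (AffineAveraging.toSite r) Lc) (l + 1 + 1))) κ κ' (Sum.inl κ₁) (Sum.inl κ₂)
        + zmode Lc (unitS₂ (sfStep Lc (l + 1 + 1)) (smStep 3 Lc (l + 1 + 1)) (SpineRooted.T2RecAt 3 Lc (AffineAveraging.toSite r) cE cVH cΛ cE₂ cB Tc vh₂S (AveragingMixedJetTables.mixFFAt (AffineAveraging.toSite r) Lc) (l + 1 + 1))) κ' κ (Sum.inl κ₁) (Sum.inl κ₂)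
        + (zmode Lc (unitS₂ (sfStep Lc (l + 1 + 1)) (smStep 3 Lc (l + 1 + 1)) (SpineRooted.T2RecAt 3 Lc (AffineAveraging.toSite r) cE cVH cΛ cE₂ cB Tc vh₂S (AveragingMixedJetTables.mixFFAt (AffineAveraging.toSite r) Lc) (l + 1 + 1))) κ κ' (Sum.inl κ₂) (Sum.inl κ₁)
        + zmode Lc (unitS₂ (sfStep Lc (l + 1 + 1)) (smStep 3 Lc (l + 1 + 1)) (SpineRooted.T2RecAt 3 Lc (AffineAveraging.toSite r) cE cVH cΛ cE₂ cB Tc vh₂S (AveragingMixedJetTables.mixFFAt (AffineAveraging.toSite r) Lc) (l + 1 + 1))) κ' κ (Sum.inl κ₂) (Sum.inl κ₁))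
      = zmode Lc (unitS₂ (sfStep Lc (l + 1)) (smStep 3 Lc (l + 1)) (SpineRooted.T2RecAt 3 Lc (AffineAveraging.toSite r) cE cVH cΛ cE₂ cB Tc vh₂S (AveragingMixedJetTables.mixFFAt (AffineAveraging.toSite r) Lc) (l + 1))) κ κ' (Sum.inl κ₁) (Sum.inl κ₂)
        + zmode Lc (unitS₂ (sfStep Lc (l + 1)) (smStep 3 Lc (l + 1)) (SpineRooted.T2RecAt 3 Lc (AffineAveraging.toSite r) cE cVH cΛ cE₂ cB Tc vh₂S (AveragingMixedJetTables.mixFFAt (AffineAveraging.toSite r) Lc) (l + 1))) κ' κ (Sum.inl κ₁) (Sum.inl κ₂)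
        + (zmode Lc (unitS₂ (sfStep Lc (l + 1)) (smStep 3 Lc (l + 1)) (SpineRooted.T2RecAt 3 Lc (AffineAveraging.toSite r) cE cVH cΛ cE₂ cB Tc vh₂S (AveragingMixedJetTables.mixFFAt (AffineAveraging.toSite r) Lc) (l + 1))) κ κ' (Sum.inl κ₂) (Sum.inl κ₁)
        + zmode Lc (unitS₂ (sfStep Lc (l + 1)) (smStep 3 Lc (l + 1)) (SpineRooted.T2RecAt 3 Lc (AffineAveraging.toSite r) cE cVH cΛ cE₂ cB Tc vh₂S (AveragingMixedJetTables.mixFFAt (AffineAveraging.toSite r) Lc) (l + 1))) κ' κ (Sum.inl κ₂) (Sum.inl κ₁)) := by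
  subst hr hcE hcVH hcΛ hcE₂ hcB hTc hvh
  have e1 : ((Lc : ℝ) ^ (3 + 1)) = (Lc : ℝ) ^ 4 := by norm_num
  have e2 : (-((Lc : ℝ) ^ (3 + 1) * (1 / 2) * (Lc : ℝ) ^ (3 + 1))) = -((Lc : ℝ) ^ 8 / 2) := by ring
  have e3 : ((Lc : ℝ) ^ (2 * (3 + 1))) = (Lc : ℝ) ^ 8 := by norm_num
  have hodd' : ∃ α : Fin 4, reflSign α κ' * reflSign α κ * reflSign α κ₁ * reflSign α κ₂ = -1 := by
    obtain ⟨α, hα⟩ := hodd; exact ⟨α, by rw [← hα]; ring⟩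
  have key : ∀ (n : ℕ) (a b : Fin 4), (∃ α : Fin 4, reflSign α a * reflSign α b * reflSign α κ₁ * reflSign α κ₂ = -1) →
      zmode Lc (unitS₂ (sfStep Lc n) (smStep 3 Lc n) (SpineRooted.T2RecAt 3 Lc (AffineAveraging.toSite (AveragingContoursRooted.ctrOff (3 + 1) Lc)) ((Lc : ℝ) ^ 4) (-((Lc : ℝ) ^ 8 / 2)) (2 / (Lc : ℝ) ^ 4) ((Lc : ℝ) ^ 8) (-((Lc : ℝ) ^ 12 / 4)) ((8 * (N : ℝ) ^ 2)⁻¹ • WilsonVertex2Sym.wsym22 N) (SecondOrderSocketIdentification.vh₂SAn1 Lc) (AveragingMixedJetTables.mixFFAt (AffineAveraging.toSite (AveragingContoursRooted.ctrOff (3 + 1) Lc)) Lc) n)) a b (Sum.inl κ₁) (Sum.inl κ₂)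
        + zmode Lc (unitS₂ (sfStep Lc n) (smStep 3 Lc n) (SpineRooted.T2RecAt 3 Lc (AffineAveraging.toSite (AveragingContoursRooted.ctrOff (3 + 1) Lc)) ((Lc : ℝ) ^ 4) (-((Lc : ℝ) ^ 8 / 2)) (2 / (Lc : ℝ) ^ 4) ((Lc : ℝ) ^ 8) (-((Lc : ℝ) ^ 12 / 4)) ((8 * (N : ℝ) ^ 2)⁻¹ • WilsonVertex2Sym.wsym22 N) (SecondOrderSocketIdentification.vh₂SAn1 Lc) (AveragingMixedJetTables.mixFFAt (AffineAveraging.toSite (AveragingContoursRooted.ctrOff (3 + 1) Lc)) Lc) n)) a b (Sum.inl κ₂) (Sum.inl κ₁) = 0 :=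
    fun n a b h => zmode_unitS₂_T2RecAt_JsRowD1Pin_add_legSwap_eq_zero hLc hN n (sfStep Lc n) (smStep 3 Lc n) h
  rw [e1, e2, e3]
  have h2a := key (l + 1 + 1) κ κ' hodd
  have h2b := key (l + 1 + 1) κ' κ hodd'
  have h1a := key (l + 1) κ κ' hodd
  have h1b := key (l + 1) κ' κ hodd'
  linarith

end Summit.QuantumFields.BalabanUV.Beta.GAN24.CombChargeParityOddLiteral

end
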